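import Summits.Ventures.DiscreteObjects.Hadamard.ElemAbelianPTools
import Summits.Ventures.DiscreteObjects.Hadamard.ElemAbelianLines

/-!
# Hadamard 668 census, family F12 — rank-2 elementary abelian groups: the REGULAR-ORBIT bound (kernel tools, general `p`)

Framing: lottery ticket; floor = certified bounds/negative ranges.

Cell pub-namedobj (venture DiscreteObjects), target (H), hadamard gen 17.  Two signed-permutation automorphisms
`A = (α, α', d₁, e₁)`, `B = (β, β', d₂, e₂)` of a Hadamard matrix `H` of order `n` with `α^p = α'^p = β^p = β'^p = 1`
(`p` an odd prime) and commuting permutation parts generate an action of `(ℤ/p)²` through `g = (a,b) ↦ α^a β^b`.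
* `card_mul_card_le_of_signed_cols`: an injective family of rows `r k` and signs `c k = ±1` such that every column of
  `T` reads `H (r k) y = c k · v y` gives `#κ · |T| ≤ n` (`‖Σ_k c_k row_{r k}‖² = #κ · n ≥ |T| · #κ²`) — the signed
  form of `card_mul_card_le_of_const_cols`.
* **`rank2_regular_bound`**: if some row `x₁` has TRIVIAL stabiliser (`α^a β^b x₁ = x₁` only for `g = 1`), then
  `p² · #{y : α' y = y ∧ β' y = y} ≤ n`: re-sign w.r.t. `A` (`exists_resign_of_odd`, so `A` acts by pure permutations)
  and fix the global sign of `B` so that the cycle product of its row signs over the `β`-orbit of `x₁` is `+1`; then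
  every column fixed by `β'` has column sign `+1` (`signedAut_pow` over `p` steps, `p` odd), so a column fixed by `α'`
  and `β'` is constant along the `p²` distinct rows `α^a (β^b x₁)` up to the row signs `∏_{t<b} d(β^t x₁)`, and the
  signed bound applies with `#κ = p²`.
This is the 'weak (E2)' inequality of FAMILY-F12-G16 §3 (a regular row orbit sees at most `n/p²` columns fixed by the
whole group) at the matrix level, with signs handled exactly (no appeal to a simultaneous re-signing of the whole
group; only `αβ = βα` on the rows is used).  Used by `ElemAbelianRank2_7`.  Ours, not literature; no `sorry`.
-/

namespace Summit.Ventures.DiscreteObjects.Hadamard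

open Finset BigOperators

open Literature.Combinatorics.Designs.GoethalsSeidel (IsHadamardMatrix)

variable {ι : Type*} [Fintype ι] [DecidableEq ι]

/-- **signed rows agreeing on many columns**: for an injective family of rows `r k` of a Hadamard matrix of order `n`,
signs `c k = ±1`, and a set `T` of columns on which `H (r k) y = c k · v y` (`v y = ±1`), `#κ · |T| ≤ n`. -/
lemma card_mul_card_le_of_signed_cols {H : Matrix ι ι ℤ} (hH : IsHadamardMatrix H) {κ : Type*} [Fintype κ]
    (r : κ → ι) (hr : Function.Injective r) (c : κ → ℤ) (hc : ∀ k, c k = 1 ∨ c k = -1)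
    (T : Finset ι) (v : ι → ℤ) (hv : ∀ y ∈ T, v y = 1 ∨ v y = -1)
    (hconst : ∀ y ∈ T, ∀ k, H (r k) y = c k * v y) :
    Fintype.card κ * T.card ≤ Fintype.card ι := by
  -- ‖Σ_k c_k row_{r k}‖²
  have key : ∑ y, (∑ k, c k * H (r k) y) * (∑ k, c k * H (r k) y) = Fintype.card κ * (Fintype.card ι : ℤ) := by
    calc ∑ y, (∑ k, c k * H (r k) y) * (∑ k, c k * H (r k) y)
        = ∑ y, ∑ k, ∑ k', (c k * c k') * (H (r k) y * H (r k') y) := by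
          apply Finset.sum_congr rfl; intro y _; rw [Finset.sum_mul_sum]
          apply Finset.sum_congr rfl; intro k _; apply Finset.sum_congr rfl; intro k' _; ring
      _ = ∑ k, ∑ k', (c k * c k') * ∑ y, H (r k) y * H (r k') y := by
          rw [Finset.sum_comm]; apply Finset.sum_congr rfl; intro k _
          rw [Finset.sum_comm]; apply Finset.sum_congr rfl; intro k' _
          rw [Finset.mul_sum]
      _ = ∑ _k : κ, (Fintype.card ι : ℤ) := by
          apply Finset.sum_congr rfl; intro k _
          rw [Finset.sum_eq_single k]
          · rw [hadamard_row_self H hH (r k), pm_mul_self (hc k), one_mul]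
          · intro k' _ hk'
            rw [hadamard_row_orth H hH (fun e => hk' (hr e).symm), mul_zero]
          · intro h; exact absurd (Finset.mem_univ k) h
      _ = Fintype.card κ * (Fintype.card ι : ℤ) := by rw [Finset.sum_const, nsmul_eq_mul, Finset.card_univ]
  -- on T each coordinate is ± #κ
  have hT : ∑ y ∈ T, (∑ k, c k * H (r k) y) * (∑ k, c k * H (r k) y) =
      T.card * ((Fintype.card κ : ℤ) * Fintype.card κ) := by
    have : ∀ y ∈ T, (∑ k, c k * H (r k) y) * (∑ k, c k * H (r k) y) = (Fintype.card κ : ℤ) * Fintype.card κ := by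
      intro y hy
      have h1 : ∀ k, c k * H (r k) y = v y := by
        intro k; rw [hconst y hy k, ← mul_assoc, pm_mul_self (hc k), one_mul]
      rw [Finset.sum_congr rfl (fun k _ => h1 k), Finset.sum_const, nsmul_eq_mul, Finset.card_univ]
      have h2 : v y * v y = 1 := pm_mul_self (hv y hy)
      calc (Fintype.card κ : ℤ) * v y * ((Fintype.card κ : ℤ) * v y)
          = (Fintype.card κ : ℤ) * Fintype.card κ * (v y * v y) := by ring
        _ = (Fintype.card κ : ℤ) * Fintype.card κ := by rw [h2, mul_one]
    rw [Finset.sum_congr rfl this, Finset.sum_const, nsmul_eq_mul]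
  have hle : ∑ y ∈ T, (∑ k, c k * H (r k) y) * (∑ k, c k * H (r k) y) ≤
      ∑ y, (∑ k, c k * H (r k) y) * (∑ k, c k * H (r k) y) :=
    Finset.sum_le_sum_of_subset_of_nonneg (Finset.subset_univ T) (fun y _ _ => mul_self_nonneg _)
  rw [hT, key] at hle
  rcases Nat.eq_zero_or_pos (Fintype.card κ) with h0 | hpos
  · rw [h0, zero_mul]; exact Nat.zero_le _
  have h3 : (T.card : ℤ) * Fintype.card κ ≤ Fintype.card ι := by
    have h2 : ((T.card : ℤ) * Fintype.card κ) * Fintype.card κ ≤ (Fintype.card ι : ℤ) * Fintype.card κ := by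
      calc ((T.card : ℤ) * Fintype.card κ) * Fintype.card κ = T.card * ((Fintype.card κ : ℤ) * Fintype.card κ) := by
            ring
        _ ≤ Fintype.card κ * (Fintype.card ι : ℤ) := hle
        _ = (Fintype.card ι : ℤ) * Fintype.card κ := by ring
    exact le_of_mul_le_mul_right h2 (by exact_mod_cast hpos)
  have h4 : ((Fintype.card κ * T.card : ℕ) : ℤ) ≤ (Fintype.card ι : ℤ) := by push_cast; linarith
  exact_mod_cast h4

section regular
variable (p : ℕ) [hp : Fact p.Prime]

/-- **regular-orbit bound.**  For a Hadamard matrix `H` of order `n`, two signed automorphisms `(α, α', d₁, e₁)`,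
`(β, β', d₂, e₂)` with `α^p = α'^p = β^p = β'^p = 1` (`p` an odd prime), `αβ = βα`, and a row `x₁`
with trivial stabiliser (`α^a β^b x₁ = x₁` only for `(a,b) = 0`): `p² · #{y : α' y = y ∧ β' y = y} ≤ n`. -/
theorem rank2_regular_bound {H : Matrix ι ι ℤ} (hH : IsHadamardMatrix H) (hodd : Odd p)
    {α α' β β' : Equiv.Perm ι} {d₁ e₁ d₂ e₂ : ι → ℤ}
    (hA : IsSignedAut H α α' d₁ e₁) (hB : IsSignedAut H β β' d₂ e₂)
    (hα : α ^ p = 1) (hα' : α' ^ p = 1) (hβ : β ^ p = 1) (hβ' : β' ^ p = 1)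
    (hc : Commute α β) (x₁ : ι)
    (hfree : ∀ g : Multiplicative (ZMod p × ZMod p),
      (α ^ (Multiplicative.toAdd g).1.val * β ^ (Multiplicative.toAdd g).2.val) x₁ = x₁ → g = 1) :
    p ^ 2 * (univ.filter fun y => α' y = y ∧ β' y = y).card ≤ Fintype.card ι := by
  classical
  haveI : Nonempty ι := ⟨x₁⟩
  -- Step 1: re-sign with respect to A
  obtain ⟨s, t', hs, ht', hH1, hinv1⟩ := exists_resign_of_odd hH hA hodd hα hα'
  set H₁ : Matrix ι ι ℤ := Matrix.of fun i j => s i * t' j * H i j with hH₁def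
  have hH1aut : ∀ i j, H₁ (α i) (α' j) = H₁ i j := by
    intro i j; simp only [hH₁def, Matrix.of_apply]; exact hinv1 i j
  have hH1ne : ∀ i j, H₁ i j ≠ 0 := fun i j => pm_ne_zero (hH1.1 i j)
  have hA' : IsSignedAut H₁ α α' (fun _ => 1) (fun _ => 1) :=
    ⟨fun _ => Or.inl rfl, fun _ => Or.inl rfl, fun i j => by rw [hH1aut i j]; ring⟩
  -- B as a signed automorphism of H₁
  set du : ι → ℤ := fun i => s (β i) * d₂ i * s i with hdu
  set eu : ι → ℤ := fun j => t' (β' j) * e₂ j * t' j with heu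
  have hBu : IsSignedAut H₁ β β' du eu := by
    refine ⟨fun i => ?_, fun j => ?_, fun i j => ?_⟩
    · rcases hs (β i) with h1 | h1 <;> rcases hB.1 i with h2 | h2 <;> rcases hs i with h3 | h3 <;>
        simp [hdu, h1, h2, h3]
    · rcases ht' (β' j) with h1 | h1 <;> rcases hB.2.1 j with h2 | h2 <;> rcases ht' j with h3 | h3 <;>
        simp [heu, h1, h2, h3]
    · simp only [hH₁def, Matrix.of_apply, hdu, heu]
      rw [hB.2.2 i j]
      have hsi : s i * s i = 1 := pm_mul_self (hs i)
      have htj : t' j * t' j = 1 := pm_mul_self (ht' j)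
      calc s (β i) * t' (β' j) * (d₂ i * e₂ j * H i j)
          = s (β i) * t' (β' j) * (d₂ i * e₂ j * H i j) * ((s i * s i) * (t' j * t' j)) := by
            rw [hsi, htj, mul_one, mul_one]
        _ = s (β i) * d₂ i * s i * (t' (β' j) * e₂ j * t' j) * (s i * t' j * H i j) := by ring
  -- Step 2: normalise the global sign of B: cycle product over the β-orbit of x₁ equal to 1
  set μ := cyc β du x₁ p with hμ
  have hμpm : μ = 1 ∨ μ = -1 := cyc_pm β du hBu.1 x₁ p
  have hμμ : μ * μ = 1 := pm_mul_self hμpm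
  set dv : ι → ℤ := fun i => μ * du i with hdv
  set ev : ι → ℤ := fun j => μ * eu j with hev
  have hBv : IsSignedAut H₁ β β' dv ev := by
    refine ⟨fun i => ?_, fun j => ?_, fun i j => ?_⟩
    · rcases hμpm with h1 | h1 <;> rcases hBu.1 i with h2 | h2 <;> simp [hdv, h1, h2]
    · rcases hμpm with h1 | h1 <;> rcases hBu.2.1 j with h2 | h2 <;> simp [hev, h1, h2]
    · rw [hBu.2.2 i j]
      simp only [hdv, hev]
      calc du i * eu j * H₁ i j = (μ * μ) * (du i * eu j * H₁ i j) := by rw [hμμ, one_mul]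
        _ = μ * du i * (μ * eu j) * H₁ i j := by ring
  have hcycv : cyc β dv x₁ p = 1 := by
    have hscale : cyc β dv x₁ p = μ ^ p * cyc β du x₁ p := by
      simp only [cyc, hdv]; rw [Finset.prod_mul_distrib, Finset.prod_const, Finset.card_range]
    have hμp : μ ^ p = μ := by
      rcases hμpm with h | h
      · rw [h, one_pow]
      · rw [h]; exact hodd.neg_one_pow
    rw [hscale, hμp, ← hμ, hμμ]
  -- Step 3: columns fixed by β' carry column sign +1
  have hfixpow : ∀ y, β' y = y → ∀ l : ℕ, (β' ^ l) y = y := by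
    intro y hy l; induction l with
    | zero => simp
    | succ l ih => rw [pow_succ', Equiv.Perm.mul_apply, ih, hy]
  have hev1 : ∀ y, β' y = y → ev y = 1 := by
    intro y hy
    have hprod := signedAut_pow hBv p x₁ y
    rw [hβ, hβ', Equiv.Perm.one_apply, Equiv.Perm.one_apply, hcycv, one_mul] at hprod
    have hcycE : cyc β' ev y p = ev y := by
      unfold cyc
      rw [Finset.prod_congr rfl (fun l _ => by rw [hfixpow y hy l]), Finset.prod_const, Finset.card_range]
      rcases hBv.2.1 y with h | h
      · rw [h, one_pow]
      · rw [h]; exact hodd.neg_one_pow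
    rw [hcycE] at hprod
    have hne := hH1ne x₁ y
    have h0 : (ev y - 1) * H₁ x₁ y = 0 := by linarith
    rcases mul_eq_zero.mp h0 with h0 | h0
    · linarith
    · exact absurd h0 hne
  -- Step 4: moving along α (columns fixed by α' are constant) and along β (sign = partial cycle product)
  have hαstep : ∀ (a : ℕ) (z y : ι), α' y = y → H₁ ((α ^ a) z) y = H₁ z y := by
    intro a z y hy
    induction a with
    | zero => simp
    | succ a ih =>
      have e := hH1aut ((α ^ a) z) y
      rw [hy] at e
      rw [pow_succ', Equiv.Perm.mul_apply, e, ih]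
  have hβstep : ∀ (b : ℕ) (y : ι), β' y = y → H₁ ((β ^ b) x₁) y = cyc β dv x₁ b * H₁ x₁ y := by
    intro b y hy
    have e := signedAut_pow hBv b x₁ y
    rw [hfixpow y hy b] at e
    have hcycE : cyc β' ev y b = 1 := by
      unfold cyc
      rw [Finset.prod_congr rfl (fun l _ => by rw [hfixpow y hy l, hev1 y hy])]
      exact Finset.prod_const_one
    rw [e, hcycE, mul_one]
  -- Step 5: the regular orbit as an injective family of rows
  set ρ : Multiplicative (ZMod p × ZMod p) → ι :=
    fun g => (α ^ (Multiplicative.toAdd g).1.val * β ^ (Multiplicative.toAdd g).2.val) x₁ with hρ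
  have hρinj : Function.Injective ρ := by
    intro g g' hgg'
    simp only [hρ] at hgg'
    have hmul := pairPerm_mul p α β hα hβ hc g (g⁻¹ * g')
    rw [mul_inv_cancel_left] at hmul
    rw [hmul, Equiv.Perm.mul_apply] at hgg'
    have hfix := (α ^ (Multiplicative.toAdd g).1.val * β ^ (Multiplicative.toAdd g).2.val).injective hgg'
    exact inv_mul_eq_one.mp (hfree (g⁻¹ * g') hfix.symm)
  set c : Multiplicative (ZMod p × ZMod p) → ℤ := fun g => cyc β dv x₁ (Multiplicative.toAdd g).2.val with hcdef
  have hcpm : ∀ g, c g = 1 ∨ c g = -1 := fun g => cyc_pm β dv hBv.1 x₁ _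
  set D := univ.filter (fun y => α' y = y ∧ β' y = y) with hDdef
  have hconst : ∀ y ∈ D, ∀ g, H₁ (ρ g) y = c g * H₁ x₁ y := by
    intro y hy g
    obtain ⟨hyα, hyβ⟩ := (Finset.mem_filter.mp hy).2
    simp only [hρ, hcdef, Equiv.Perm.mul_apply]
    rw [hαstep _ _ y hyα, hβstep _ y hyβ]
  have hbound := card_mul_card_le_of_signed_cols hH1 ρ hρinj c hcpm D (fun y => H₁ x₁ y)
    (fun y _ => hH1.1 x₁ y) hconst
  have hcardG : Fintype.card (Multiplicative (ZMod p × ZMod p)) = p ^ 2 := by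
    rw [Fintype.card_multiplicative, Fintype.card_prod, ZMod.card, sq]
  rw [hcardG] at hbound
  exact hbound

end regular

end Summit.Ventures.DiscreteObjects.Hadamard
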